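import Mathlib
import Literature.NumberTheory.Irrationality.KrattenthalerRivoal2007.DenominatorsTheorem
import Summits.KontsevichZagierPeriods.Zeta5Search.BrickLinearForms

/-!
# BrickDenominators — the Krattenthaler–Rivoal denominator exponent `A − 1 − s` of the very-well-poised brick linear
forms at EVERY ODD PRIME, from zi-p2's PROPOSITION H^∞ with the constant weight; Zudilin's (14) at odd primes
(cell zeta5-irr)

HONEST FRAMING: systematic search; no irrationality claim unless certified. INSTRUMENT-tier arithmetic of the ζ(5)
census cell zeta5-irr (HOME `run/shared/lean/pub/zeta5-irr/`), filed by the engine seat zi-eng (g12). WHAT THIS IS NOT: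
no NEW denominator saving for any ζ(5) form — the exponent proved here is exactly Krattenthaler–Rivoal's (Mem. AMS 875,
2007, Théorème 1), in print since 2007; nothing at the prime `2` (where the printed factor `2` of Théorème 1 (ii) lives,
`KrattenthalerRivoal2007.conjecture1_constantTerm_false`); nothing about ζ(5); 0 nats/n; rung F-Z1 NOT moved. What is new
is the ROUTE and the kernel status: the cell's Dwork-digit machinery (`BrickPropositionHInf`, zi-p2's THEOREMS 8–10)
CONTAINS the denominators theorem at odd primes as a one-step corollary, and localises it to residue classes mod `p`.

## Objects (all from the chain)

`R_n^{(A,B,1)}(t) = n!^{A−2B}(t + n/2)∏_{m=1}^{n}(t−m)^B∏_{m=1}^{n}(t+n+m)^B/∏_{m=0}^{n}(t+m)^A = Σ_{K≤n}Σ_{s≤A} c_{K,s}(n)(t+K)^{−s}`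
(`BrickLaurent.cell`, `BrickPartialFractions.brickKernel_eq_sum_cell`), `x_s(n) = Σ_K c_{K,s}(n)` (`xCoeff`),
`x_0(n) = −Σ_KΣ_s c_{K,s}(n)H_K^{(s)}` (`xZero`), so that `Σ_{k≥1}R_n(k) = Σ_s x_s(n)ζ(s) + x_0(n)` (`BrickLinearForms`);
`d_n = lcm(1,…,n) = Nat.lcmUpto n`, `v = Rat.padicValuation p` (`v(x) ≤ exp(m)` ⟺ `x = 0 ∨ ord_p x ≥ −m`).

## The observation

`BrickPropositionHInf.level_step_inf` (the induction step of zi-p2's PROPOSITION H^∞; hypotheses: `p ≠ 2`, `A` even,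
`1 ≤ B`, `2B ≤ A`) proves `v(Σ_k g(k)·p^{(L+1)(A−s)}c_{k,s}(n)) ≤ exp(−(L+1))` for the kernel `ε = 1` and EVERY weight `g`
that is `p`-integral (I), SYMMETRIC `g(n−k) − g(k) ≡ 0` (S_1) and digit-local (D). The digit theorems of the chain use
the weight `u = (Φ−1)/p³`; the CONSTANT weight `g ≡ 1` satisfies (I), (S_1), (D) trivially. Hence:

## Statements proved here (`p` an ODD prime throughout — `p = 3` included —, `A` even, `1 ≤ B`, `2B ≤ A`)

* `level_const`: for EVERY `L` and `n < p^{L+1}`: `v(p^{LA}x_0(n)) ≤ exp(−L)` and `v(p^{L(A−s)}x_s(n)) ≤ exp(−L)`, all `s`.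
* `padicValuation_xCoeff_le`, `padicValuation_xZero_le`: **`ord_p x_s(n) ≥ −⌊log_p n⌋·(A−1−s)`**,
  **`ord_p x_0(n) ≥ −⌊log_p n⌋·(A−1)`** for every `n`, `s` — one `⌊log_p n⌋` better than the termwise bound
  `ord_p c_{K,s}(n) ≥ −⌊log_p n⌋(A−s)` (`BrickTopKummer.cell_one_valuation_abs`), which fails for `x_s` cell by cell.
* `padicValuation_lcmUpto_pow_mul_xCoeff_le`, `…_xZero_le`: **`d_n^{A−1−s}x_s(n) ∈ ℤ_(p)`, `d_n^{A−1}x_0(n) ∈ ℤ_(p)`**;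
  across the odd primes (`den_lcmUpto_pow_mul_xCoeff`, `…_xZero`, `exists_two_pow_mul_…`): the denominators of
  `d_n^{A−1−s}x_s(n)` and `d_n^{A−1}x_0(n)` are powers of `2`.
* (sequel `BrickClassDenominators`: the same exponent for the partial sums over residue classes mod `p`.)
* In KRATTENTHALER–RIVOAL's vocabulary (tree file `Literature/…/KrattenthalerRivoal2007/DenominatorsTheorem`, named fact
  `theoreme1`, NOT discharged here): the cells are their partial-fraction data of `R_{n,A,B,1}` (`isPartialFractionData_cell`,
  `eval_numeratorR_one_eq`), `p_{l,n}(1) = x_l(n)`, `p_{0,0,n}(1) = x_0(n)` (`pCoeff_one_eq_xCoeff`, `pZero_one_eq_xZero`), and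
  **`theoreme1_odd_prime`**: for `r = 1`, `C = 0`, `A` even, `2B ≤ A`, every odd `p`, every `n` and data `c`:
  `d_n^{A−l−1}p_{l,n}((−1)^A) ∈ ℤ_(p)` (`1 ≤ l ≤ A−1`) and `d_n^{A+0−1}p_{0,0,n}((−1)^A) ∈ ℤ_(p)`; `theoreme1_den_two_pow`.
  [Krattenthaler–Rivoal, *Hypergéométrie et fonction zêta de Riemann*, Mem. AMS 186 (2007) no. 875, §3 Théorème 1;
  arXiv:math/0311114 p. 8.]
* ZUDILIN 2002, inclusions (14) at odd primes (`(6,1,1)` = the summand of `rₙ = uₙζ(5) + wₙζ(3) − vₙ`, Math. Notes 72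
  (2002), via `BrickLinearForms.uC_eq_xCoeff` …): **`uₙ ∈ ℤ_(p)`, `d_n²wₙ ∈ ℤ_(p)`, `d_n⁵vₙ ∈ ℤ_(p)`** for every odd `p`
  (`padicValuation_uC_le`, `padicValuation_lcmUpto_sq_mul_wC_le`, `padicValuation_lcmUpto_pow_five_mul_vC_le`); the
  denominator of `uₙ = 1, 9, 469, 38601, …` is a power of `2` (`den_uC`; print: `2uₙ ∈ ℤ`, via Vasilyev's integrals).

PROOF ROUTE vs PRINT: Krattenthaler–Rivoal prove Théorème 1 by rewriting `p_{l,n}(±1)` as a multiple hypergeometric sum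
with integral summands (Andrews's identity; their §5); Zudilin derives (14) from Vasilyev's multiple integrals. Here the
`p`-part, `p` odd, drops out of the `p`-adic digit induction H^∞ — presearch (g12): no `p`-adic/Dwork-type proof of the
denominators theorem found (corpus hybrid + vector: «p-adic proof denominators conjecture very-well-poised», galaxy
«denominators conjecture|conjecture des dénominateurs», all stars; nearest: KR07 itself, Zudilin 2004 JTNB §7 Lemmas
17–18 (termwise), Zudilin arXiv:1611.08806 (survey)); the parent's LIT-ASPRINTED §5.4 records the same absence. Exact
pre-typing check (this seat, local, exact arithmetic): the bounds hold with 0 failures on `(A,B) ∈ {(4,1),(6,1),(6,2),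
(8,1),(8,2),(8,3)}`, `n ≤ 12`, `p ∈ {3,5,7,11}`, while the termwise bound fails in 296 of 1 932 cells (`p ∈ {3,5}`, odd `s`).
-/

namespace Summit.KontsevichZagierPeriods.Zeta5Search.BrickDenominators

open Finset Nat WithZero
open Summit.KontsevichZagierPeriods.Zeta5Search.BrickLaurent (cell)
open Summit.KontsevichZagierPeriods.Zeta5Search.BrickPartialFractions (cellZero xCoeff xZero)
open Summit.KontsevichZagierPeriods.Zeta5Search.BrickTopKummer (cell_one_valuation_abs)
open Summit.KontsevichZagierPeriods.Zeta5Search.BrickHoleCells (pow_mul_cellZero_valuation)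
open Summit.KontsevichZagierPeriods.Zeta5Search.BrickPropositionHInf (level_step_inf propositionH_inf)

noncomputable section

variable {p : ℕ} [Fact p.Prime]

/-! ## PROPOSITION H^∞ with the constant weight `g ≡ 1` -/

section const

variable (hp2 : p ≠ 2) {A B : ℕ} (hA : Even A) (hB : 1 ≤ B) (hAB : 2 * B ≤ A)
include hp2 hA hB hAB

/-- **H^∞, constant weight** (every odd prime `p`, `A` even, `1 ≤ B`, `2B ≤ A`; EVERY level `L`, row `n < p^{L+1}` of
the very-well-poised kernel `ε = 1`): `v(p^{LA}·x_0(n)) ≤ exp(−L)` and `v(p^{L(A−s)}·x_s(n)) ≤ exp(−L)` for every `s` —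
`BrickPropositionHInf.level_step_inf` with the weight `g ≡ 1`, which satisfies (I), (S_1) `g(n−k) − g(k) = 0`, (D)
trivially; level `0` is plain `p`-integrality of the cells (`n < p`). -/
theorem level_const {L n : ℕ} (hn : n < p ^ (L + 1)) :
    Rat.padicValuation p ((p : ℚ) ^ (L * A) * xZero A B 1 n) ≤ exp (-(L : ℤ)) ∧
      ∀ s, Rat.padicValuation p ((p : ℚ) ^ (L * (A - s)) * xCoeff A B 1 n s) ≤ exp (-(L : ℤ)) := by
  have hp : p.Prime := Fact.out
  rcases L with _ | L
  · refine ⟨?_, fun s => ?_⟩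
    · rw [Nat.cast_zero, neg_zero, exp_zero, zero_mul, xZero, Finset.mul_sum]
      refine Valuation.map_sum_le _ fun j hj => ?_
      have hj' : j ≤ n := by have := mem_range.1 hj; omega
      refine (pow_mul_cellZero_valuation hp2 hAB (L := 0) hn hj' 0).trans (exp_le_exp.2 ?_)
      simp only [Nat.cast_zero, zero_mul, Nat.cast_mul]
      nlinarith [Int.natCast_nonneg A, Int.natCast_nonneg (padicValNat p (n.choose j))]
    · rw [Nat.cast_zero, neg_zero, exp_zero, zero_mul, pow_zero, one_mul, xCoeff]
      refine Valuation.map_sum_le _ fun j hj => ?_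
      have hj' : j ≤ n := by have := mem_range.1 hj; omega
      have h := cell_one_valuation_abs hp2 hAB (L := 0) hn hj' s
      rwa [Nat.cast_zero, zero_mul, exp_zero] at h
  · obtain ⟨n₀, N, hn₀, rfl⟩ : ∃ n₀ N, n₀ < p ∧ n = n₀ + N * p :=
      ⟨n % p, n / p, Nat.mod_lt _ hp.pos, (Nat.mod_add_div' n p).symm⟩
    have hN : N < p ^ (L + 1) := by
      rw [Nat.lt_iff_add_one_le]
      by_contra h
      have h' : p ^ (L + 1) ≤ N := by omega
      have : p ^ (L + 1 + 1) ≤ n₀ + N * p := by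
        calc p ^ (L + 1 + 1) = p ^ (L + 1) * p := pow_succ _ _
          _ ≤ N * p := Nat.mul_le_mul_right _ h'
          _ ≤ n₀ + N * p := Nat.le_add_left _ _
      omega
    have h := level_step_inf hp2 hA hB hAB (ε := 1) le_rfl hn₀ hN (g := fun _ : ℕ => (1 : ℚ))
      (fun k _ => (map_one _).le) (fun k _ => ?_) (fun e k k' _ _ _ _ _ => ?_)
      (fun M' hM' g' h1 h2 h3 => propositionH_inf hp2 hA hB hAB L M' hM' g' h1 h2 h3)
    · simp only [one_mul, ← Finset.mul_sum] at h
      simp only [xZero, xCoeff]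
      exact_mod_cast h
    · rw [pow_one, neg_one_mul, add_neg_cancel, map_zero]
      exact _root_.zero_le
    · rw [sub_self, map_zero]
      exact _root_.zero_le

end const

/-! ## The Krattenthaler–Rivoal exponent `A − 1 − s` at every odd prime -/

/-- From `v(p^m·x) ≤ exp(−L)` to `v(x) ≤ exp(m − L)`. [folklore] -/
theorem le_exp_of_pow_mul_le {x : ℚ} {m : ℕ} {L : ℤ}
    (h : Rat.padicValuation p ((p : ℚ) ^ m * x) ≤ exp (-L)) :
    Rat.padicValuation p x ≤ exp ((m : ℤ) - L) := by
  rw [map_mul, map_pow, Rat.padicValuation_self, ← exp_nsmul, nsmul_eq_mul, mul_neg_one] at h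
  have h' := mul_le_mul_right h (exp (m : ℤ))
  rwa [← mul_assoc, ← exp_add, add_neg_cancel, exp_zero, one_mul, ← exp_add, ← sub_eq_add_neg] at h'

/-- `v(d_n) = exp(−⌊log_p n⌋)` for `d_n = lcm(1,…,n) = Nat.lcmUpto n` (`p^{⌊log_p n⌋} ∥ d_n`). [folklore] -/
theorem padicValuation_lcmUpto (n : ℕ) :
    Rat.padicValuation p ((Nat.lcmUpto n : ℕ) : ℚ) = exp (-(Nat.log p n : ℤ)) := by
  have hp : p.Prime := Fact.out
  have h0 : ((Nat.lcmUpto n : ℕ) : ℚ) ≠ 0 := by exact_mod_cast (Nat.lcmUpto_pos n).ne'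
  simp only [Rat.padicValuation, Valuation.coe_mk, MonoidWithZeroHom.coe_mk, ZeroHom.coe_mk, if_neg h0,
    padicValRat.of_nat, ← Nat.factorization_def _ hp, Nat.factorization_lcmUpto n hp]

section odd

variable (hp2 : p ≠ 2) {A B : ℕ} (hA : Even A) (hB : 1 ≤ B) (hAB : 2 * B ≤ A)
include hp2 hA hB hAB

/-- **`ord_p x_s(n) ≥ −⌊log_p n⌋·(A−1−s)`** for every odd prime `p`, every `n` and every `s` (very-well-poised brick
kernel `(A,B,1)`, `A` even, `1 ≤ B ≤ A/2`): `v(x_s(n)) ≤ exp(⌊log_p n⌋·(A−1−s))`. This is the `p`-part of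
Krattenthaler–Rivoal's `d_n^{A−1−s}·p_{s,n}(1) ∈ ℤ` (Mem. AMS 875 (2007) Théorème 1 (i), case `r = 1`), obtained here from
PROPOSITION H^∞ with the constant weight — one `⌊log_p n⌋` better than the termwise bound `ord_p c_{K,s}(n) ≥ −⌊log_p n⌋(A−s)`
of `BrickTopKummer.cell_one_valuation_abs`. -/
theorem padicValuation_xCoeff_le (n s : ℕ) :
    Rat.padicValuation p (xCoeff A B 1 n s) ≤ exp ((Nat.log p n : ℤ) * ((A - 1 - s : ℕ) : ℤ)) := by
  have hp : p.Prime := Fact.out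
  have hn : n < p ^ (Nat.log p n + 1) := Nat.lt_pow_succ_log_self hp.one_lt n
  refine (le_exp_of_pow_mul_le ((level_const hp2 hA hB hAB hn).2 s)).trans (exp_le_exp.2 ?_)
  have hτ : (A - s : ℕ) ≤ (A - 1 - s : ℕ) + 1 := by omega
  have hτ' : ((A - s : ℕ) : ℤ) ≤ ((A - 1 - s : ℕ) : ℤ) + 1 := by exact_mod_cast hτ
  push_cast
  nlinarith [Int.natCast_nonneg (Nat.log p n), Int.natCast_nonneg (A - 1 - s)]

/-- **`ord_p x_0(n) ≥ −⌊log_p n⌋·(A−1)`** for every odd prime `p` and every `n`: `v(x_0(n)) ≤ exp(⌊log_p n⌋·(A−1))` — the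
`p`-part (odd `p`) of Krattenthaler–Rivoal's `2·d_n^{A−1}·p_{0,0,n}(1) ∈ ℤ` (Théorème 1 (ii), `r = 1`, `C = 0`). -/
theorem padicValuation_xZero_le (n : ℕ) :
    Rat.padicValuation p (xZero A B 1 n) ≤ exp ((Nat.log p n : ℤ) * ((A - 1 : ℕ) : ℤ)) := by
  have hp : p.Prime := Fact.out
  have hn : n < p ^ (Nat.log p n + 1) := Nat.lt_pow_succ_log_self hp.one_lt n
  refine (le_exp_of_pow_mul_le (level_const hp2 hA hB hAB hn).1).trans (exp_le_exp.2 ?_)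
  have hA1 : 1 ≤ A := by omega
  push_cast [Nat.cast_sub hA1]
  nlinarith [Int.natCast_nonneg (Nat.log p n)]

/-- **`d_n^{A−1−s}·x_s(n) ∈ ℤ_(p)` for every odd prime `p`** (`d_n = lcm(1,…,n)`): Krattenthaler–Rivoal 2007
Théorème 1 (i) for the very-well-poised brick kernel `(A,B,1)` (`r = 1`, `A` even, `z = (−1)^A = 1`), prime by prime
away from `p = 2`. -/
theorem padicValuation_lcmUpto_pow_mul_xCoeff_le (n s : ℕ) :
    Rat.padicValuation p (((Nat.lcmUpto n : ℕ) : ℚ) ^ (A - 1 - s) * xCoeff A B 1 n s) ≤ 1 := by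
  rw [map_mul, map_pow, padicValuation_lcmUpto, ← exp_nsmul, nsmul_eq_mul]
  refine (mul_le_mul_right (padicValuation_xCoeff_le hp2 hA hB hAB n s) _).trans (le_of_eq ?_)
  rw [← exp_add, ← exp_zero]
  congr 1
  ring

/-- **`d_n^{A−1}·x_0(n) ∈ ℤ_(p)` for every odd prime `p`**: Krattenthaler–Rivoal 2007 Théorème 1 (ii) (`r = 1`,
`C = 0`, `A` even) prime by prime away from `p = 2` — where the printed statement carries the factor `2`
(`2·d_n^{A−1}·p_{0,0,n}(1) ∈ ℤ`; the factor IS needed at `p = 2`: `KrattenthalerRivoal2007.conjecture1_constantTerm_false`). -/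
theorem padicValuation_lcmUpto_pow_mul_xZero_le (n : ℕ) :
    Rat.padicValuation p (((Nat.lcmUpto n : ℕ) : ℚ) ^ (A - 1) * xZero A B 1 n) ≤ 1 := by
  rw [map_mul, map_pow, padicValuation_lcmUpto, ← exp_nsmul, nsmul_eq_mul]
  refine (mul_le_mul_right (padicValuation_xZero_le hp2 hA hB hAB n) _).trans (le_of_eq ?_)
  rw [← exp_add, ← exp_zero]
  congr 1
  ring

end odd

/-! ## Across the odd primes: the denominators of `d_n^{A−1−s}x_s(n)`, `d_n^{A−1}x_0(n)` are powers of `2` -/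

/-- A rational number which is `p`-integral at every odd prime `p` has a power of `2` as its denominator. [folklore] -/
theorem den_eq_two_pow_of_padicValuation_le {q : ℚ}
    (h : ∀ (p : ℕ) (hp : p.Prime), p ≠ 2 → @Rat.padicValuation p ⟨hp⟩ q ≤ 1) :
    ∃ k : ℕ, q.den = 2 ^ k := by
  refine ⟨_, Nat.eq_prime_pow_of_unique_prime_dvd q.den_ne_zero fun {d} hd hdvd => ?_⟩
  by_contra hd2
  have h' := h d hd hd2
  rw [@Rat.padicValuation_le_one_iff d ⟨hd⟩] at h'
  exact h' hdvd

/-- A rational number which is `p`-integral at every odd prime `p` becomes an integer after multiplication by a power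
of `2`. [folklore] -/
theorem exists_two_pow_mul_eq_int_of_padicValuation_le {q : ℚ}
    (h : ∀ (p : ℕ) (hp : p.Prime), p ≠ 2 → @Rat.padicValuation p ⟨hp⟩ q ≤ 1) :
    ∃ k : ℕ, ∃ z : ℤ, (2 : ℚ) ^ k * q = z := by
  obtain ⟨k, hk⟩ := den_eq_two_pow_of_padicValuation_le h
  refine ⟨k, q.num, ?_⟩
  rw [← Rat.den_mul_eq_num q, hk]
  push_cast
  rfl

section global

variable {A B : ℕ} (hA : Even A) (hB : 1 ≤ B) (hAB : 2 * B ≤ A)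
include hA hB hAB

/-- **Krattenthaler–Rivoal Théorème 1 (i) up to a power of `2`**: for the very-well-poised brick kernel `(A,B,1)` (`A`
even, `1 ≤ B ≤ A/2`) and every `n`, `s`, the denominator of `d_n^{A−1−s}·x_s(n)` is a power of `2`. (The print has no
power of `2` at all for `s ≥ 1`; the `2`-adic analysis is not part of this file.) -/
theorem den_lcmUpto_pow_mul_xCoeff (n s : ℕ) :
    ∃ k : ℕ, (((Nat.lcmUpto n : ℕ) : ℚ) ^ (A - 1 - s) * xCoeff A B 1 n s).den = 2 ^ k :=
  den_eq_two_pow_of_padicValuation_le fun p hp hp2 =>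
    @padicValuation_lcmUpto_pow_mul_xCoeff_le p ⟨hp⟩ hp2 A B hA hB hAB n s

/-- **Krattenthaler–Rivoal Théorème 1 (ii) up to a power of `2`**: the denominator of `d_n^{A−1}·x_0(n)` is a power of
`2` (the print: `2·d_n^{A−1}·p_{0,0,n}(1) ∈ ℤ`). -/
theorem den_lcmUpto_pow_mul_xZero (n : ℕ) :
    ∃ k : ℕ, (((Nat.lcmUpto n : ℕ) : ℚ) ^ (A - 1) * xZero A B 1 n).den = 2 ^ k :=
  den_eq_two_pow_of_padicValuation_le fun p hp hp2 =>
    @padicValuation_lcmUpto_pow_mul_xZero_le p ⟨hp⟩ hp2 A B hA hB hAB n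

/-- `2^k · d_n^{A−1−s} · x_s(n) ∈ ℤ` for some `k`. -/
theorem exists_two_pow_mul_lcmUpto_pow_mul_xCoeff (n s : ℕ) :
    ∃ k : ℕ, ∃ z : ℤ, (2 : ℚ) ^ k * (((Nat.lcmUpto n : ℕ) : ℚ) ^ (A - 1 - s) * xCoeff A B 1 n s) = z :=
  exists_two_pow_mul_eq_int_of_padicValuation_le fun p hp hp2 =>
    @padicValuation_lcmUpto_pow_mul_xCoeff_le p ⟨hp⟩ hp2 A B hA hB hAB n s

/-- `2^k · d_n^{A−1} · x_0(n) ∈ ℤ` for some `k`. -/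
theorem exists_two_pow_mul_lcmUpto_pow_mul_xZero (n : ℕ) :
    ∃ k : ℕ, ∃ z : ℤ, (2 : ℚ) ^ k * (((Nat.lcmUpto n : ℕ) : ℚ) ^ (A - 1) * xZero A B 1 n) = z :=
  exists_two_pow_mul_eq_int_of_padicValuation_le fun p hp hp2 =>
    @padicValuation_lcmUpto_pow_mul_xZero_le p ⟨hp⟩ hp2 A B hA hB hAB n

end global

/-! ## In Krattenthaler–Rivoal's vocabulary (`KrattenthalerRivoal2007.DenominatorsTheorem`: `r = 1`, `C = 0`, `A` even) -/

section KR

open Polynomial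
open Literature.NumberTheory.Irrationality.KrattenthalerRivoal2007 (numeratorR IsPartialFractionData pCoeff pZero
  numeratorR_eval)
open Literature.NumberTheory.Transcendental.BallRivoal (pfEval poch)
open Summit.KontsevichZagierPeriods.Zeta5Search.BrickLaurent (kerNum eval_kerNum)
open Summit.KontsevichZagierPeriods.Zeta5Search.BrickLinearForms (pfEval_cell brickKernel_succ_eq poch_sub_natCast
  poch_add_natCast_succ)

/-- Krattenthaler–Rivoal's numerator of `R_{n,A,B,1}` IS the tree's `kerNum A B 1 n` (`2B ≤ A`):
`(n!^A/n!^{2B})(x + n/2)(x−n)_n^B(x+n+1)_n^B = n!^{A−2B}(x + n/2)∏_{m=1}^{n}(x−m)^B∏_{m=1}^{n}(x+n+m)^B`. -/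
theorem eval_numeratorR_one_eq {A B : ℕ} (hAB : 2 * B ≤ A) (n : ℕ) (x : ℚ) :
    (numeratorR n A B 1).eval x = (kerNum A B 1 n).eval x := by
  have hne : (n ! : ℚ) ≠ 0 := by positivity
  rw [numeratorR_eval, eval_kerNum]
  simp only [mul_one, one_mul]
  rw [pow_sub₀ _ hne hAB, ← div_eq_mul_inv, pow_one, poch_sub_natCast,
    show x + ((n + 1 : ℕ) : ℚ) = x + n + 1 by push_cast; ring, poch_add_natCast_succ]
  ring

/-- **The tree's cells are Krattenthaler–Rivoal's partial-fraction data of `R_{n,A,B,1}`** (`2B ≤ A`, `1 < A`). -/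
theorem isPartialFractionData_cell {A B : ℕ} (hAB : 2 * B ≤ A) (hA : 1 < A) (n : ℕ) :
    IsPartialFractionData n A B 1 (fun o K => cell A B 1 n K (o + 1)) := fun t ht => by
  rw [pfEval_cell hAB hA n ht, brickKernel_succ_eq, eval_comp, eval_add, eval_X, eval_C, eval_numeratorR_one_eq hAB]

/-- Any partial-fraction data of `R_{n,A,B,1}` agree with the cells on the support `o < A`, `K ≤ n`. -/
theorem data_eq_cell {A B : ℕ} (hAB : 2 * B ≤ A) (hA : 1 < A) {n : ℕ} {c : ℕ → ℕ → ℚ}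
    (hc : IsPartialFractionData n A B 1 c) {o K : ℕ} (ho : o < A) (hK : K ≤ n) :
    c o K = cell A B 1 n K (o + 1) :=
  hc.unique (isPartialFractionData_cell hAB hA n) ho hK

/-- **`p_{l,n}(1) = x_l(n)`**: Krattenthaler–Rivoal's coefficient polynomial at `z = 1` is zi-p2's `x_l` (`1 ≤ l ≤ A`). -/
theorem pCoeff_one_eq_xCoeff {A B : ℕ} (hAB : 2 * B ≤ A) (hA : 1 < A) {n : ℕ} {c : ℕ → ℕ → ℚ}
    (hc : IsPartialFractionData n A B 1 c) {l : ℕ} (hl : 1 ≤ l) (hlA : l ≤ A) :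
    pCoeff n c l 1 = xCoeff A B 1 n l := by
  rw [pCoeff, xCoeff]
  refine Finset.sum_congr rfl fun K hK => ?_
  rw [one_pow, mul_one, data_eq_cell hAB hA hc (by omega) (by have := mem_range.1 hK; omega), Nat.sub_add_cancel hl]

/-- **`p_{0,0,n}(1) = x_0(n)`**: Krattenthaler–Rivoal's constant term at `z = 1`, `C = 0`, is zi-p2's `x_0`. -/
theorem pZero_one_eq_xZero {A B : ℕ} (hAB : 2 * B ≤ A) (hA : 1 < A) {n : ℕ} {c : ℕ → ℕ → ℚ}
    (hc : IsPartialFractionData n A B 1 c) : pZero n A 0 c 1 = xZero A B 1 n := by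
  rw [pZero, xZero, ← Finset.sum_neg_distrib]
  refine Finset.sum_congr rfl fun K hK => ?_
  have hKn : K ≤ n := by have := mem_range.1 hK; omega
  rw [cellZero]
  refine congrArg Neg.neg (Finset.sum_congr rfl fun e he => ?_)
  have he' := mem_Icc.1 he
  rw [pow_zero, one_mul, zero_add, Nat.choose_self, Nat.cast_one, one_mul,
    data_eq_cell hAB hA hc (by omega) hKn, Nat.sub_add_cancel he'.1]
  refine congrArg _ (Finset.sum_congr rfl fun i _ => ?_)
  rw [one_pow, add_zero]

variable (hp2 : p ≠ 2) {A B : ℕ} (hA : Even A) (hB : 1 ≤ B) (hAB : 2 * B ≤ A)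
include hA hB hAB

section
include hp2

/-- **Krattenthaler–Rivoal 2007, Théorème 1 AT EVERY ODD PRIME — case `r = 1`, `C = 0`, `A` even** (the very-well-poised
brick kernels; in the vocabulary of the tree's named fact `KrattenthalerRivoal2007.theoreme1`): for every odd prime `p`,
every `n` and all partial-fraction data `c` of `R_{n,A,B,1}`: (i) `d_n^{A−l−1}·p_{l,n}((−1)^A) ∈ ℤ_(p)` for `1 ≤ l ≤ A−1`;
(ii) `d_n^{A+0−1}·p_{0,0,n}((−1)^A) ∈ ℤ_(p)` (no factor `2` is needed at odd `p`). PROOF ROUTE: zi-p2's PROPOSITION H^∞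
(Dwork-digit induction, `BrickPropositionHInf`) with the constant weight — not the source's (Andrews's multisum identity).
WHAT THIS IS NOT: not the named fact itself (which is for all `A ≥ 2`, `C ≥ 0`, `r ≥ 0` and includes `p = 2`). -/
theorem theoreme1_odd_prime {n : ℕ} {c : ℕ → ℕ → ℚ} (hc : IsPartialFractionData n A B 1 c) :
    (∀ l : ℕ, 1 ≤ l → l + 1 ≤ A →
        Rat.padicValuation p (((Nat.lcmUpto n : ℕ) : ℚ) ^ (A - l - 1) * pCoeff n c l ((-1) ^ A)) ≤ 1) ∧
      Rat.padicValuation p (((Nat.lcmUpto n : ℕ) : ℚ) ^ (A + 0 - 1) * pZero n A 0 c ((-1) ^ A)) ≤ 1 := by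
  have hA1 : 1 < A := by omega
  have h1 : ((-1 : ℚ)) ^ A = 1 := hA.neg_one_pow
  refine ⟨fun l hl hlA => ?_, ?_⟩
  · rw [h1, pCoeff_one_eq_xCoeff hAB hA1 hc hl (by omega), show A - l - 1 = A - 1 - l by omega]
    exact padicValuation_lcmUpto_pow_mul_xCoeff_le hp2 hA hB hAB n l
  · rw [h1, pZero_one_eq_xZero hAB hA1 hc, Nat.add_zero]
    exact padicValuation_lcmUpto_pow_mul_xZero_le hp2 hA hB hAB n

end

/-- **Théorème 1 (`r = 1`, `C = 0`, `A` even) up to powers of `2`**: the denominators of `d_n^{A−l−1}·p_{l,n}((−1)^A)`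
(`1 ≤ l ≤ A−1`) and of `d_n^{A−1}·p_{0,0,n}((−1)^A)` are powers of `2`. -/
theorem theoreme1_den_two_pow {n : ℕ} {c : ℕ → ℕ → ℚ} (hc : IsPartialFractionData n A B 1 c) :
    (∀ l : ℕ, 1 ≤ l → l + 1 ≤ A →
        ∃ k : ℕ, (((Nat.lcmUpto n : ℕ) : ℚ) ^ (A - l - 1) * pCoeff n c l ((-1) ^ A)).den = 2 ^ k) ∧
      ∃ k : ℕ, (((Nat.lcmUpto n : ℕ) : ℚ) ^ (A + 0 - 1) * pZero n A 0 c ((-1) ^ A)).den = 2 ^ k :=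
  ⟨fun l hl hlA => den_eq_two_pow_of_padicValuation_le fun p hp hp2 =>
      (@theoreme1_odd_prime p ⟨hp⟩ hp2 A B hA hB hAB n c hc).1 l hl hlA,
    den_eq_two_pow_of_padicValuation_le fun p hp hp2 => (@theoreme1_odd_prime p ⟨hp⟩ hp2 A B hA hB hAB n c hc).2⟩

end KR

/-! ## Zudilin 2002, inclusions (14), at every odd prime: `uₙ, d_n²wₙ, d_n⁵vₙ ∈ ℤ_(p)` -/

section Zudilin

open Literature.NumberTheory.Irrationality.Zudilin2002 (uC wC vC)
open Summit.KontsevichZagierPeriods.Zeta5Search.BrickLinearForms (uC_eq_xCoeff wC_eq_xCoeff vC_eq_neg_xZero)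

/-- **`uₙ ∈ ℤ_(p)` for every odd prime `p`** — Zudilin's `ζ(5)`-coefficient `uₙ = 1, 9, 469, 38601, …` of
`rₙ = uₙζ(5) + wₙζ(3) − vₙ` (Math. Notes 72 (2002), (7), (14): `2uₙ ∈ ℤ` in print, via Vasilyev's integrals;
Krattenthaler–Rivoal 2007 Thm 1: `uₙ ∈ ℤ`). Kernel `(6,1,1)`, `s = 5`, exponent `A − 1 − s = 0`. -/
theorem padicValuation_uC_le (hp2 : p ≠ 2) (n : ℕ) : Rat.padicValuation p (uC n) ≤ 1 := by
  have h := padicValuation_lcmUpto_pow_mul_xCoeff_le hp2 (A := 6) (B := 1) (by decide) le_rfl (by norm_num) n 5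
  rwa [show 6 - 1 - 5 = 0 from rfl, pow_zero, one_mul, ← uC_eq_xCoeff] at h

/-- **`d_n²·wₙ ∈ ℤ_(p)` for every odd prime `p`** (Zudilin 2002 (14): `2D_n²wₙ ∈ ℤ`). -/
theorem padicValuation_lcmUpto_sq_mul_wC_le (hp2 : p ≠ 2) (n : ℕ) :
    Rat.padicValuation p (((Nat.lcmUpto n : ℕ) : ℚ) ^ 2 * wC n) ≤ 1 := by
  have h := padicValuation_lcmUpto_pow_mul_xCoeff_le hp2 (A := 6) (B := 1) (by decide) le_rfl (by norm_num) n 3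
  rwa [show 6 - 1 - 3 = 2 from rfl, ← wC_eq_xCoeff] at h

/-- **`d_n⁵·vₙ ∈ ℤ_(p)` for every odd prime `p`** (Zudilin 2002 (14): `2D_n⁵vₙ ∈ ℤ`). -/
theorem padicValuation_lcmUpto_pow_five_mul_vC_le (hp2 : p ≠ 2) (n : ℕ) :
    Rat.padicValuation p (((Nat.lcmUpto n : ℕ) : ℚ) ^ 5 * vC n) ≤ 1 := by
  have h := padicValuation_lcmUpto_pow_mul_xZero_le hp2 (A := 6) (B := 1) (by decide) le_rfl (by norm_num) n
  rwa [show 6 - 1 = 5 from rfl, ← Valuation.map_neg, ← mul_neg, ← vC_eq_neg_xZero] at h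

/-- The denominator of `uₙ` is a power of `2` (print: `2uₙ ∈ ℤ`; the `2`-adic statement is not typed here). -/
theorem den_uC (n : ℕ) : ∃ k : ℕ, (uC n).den = 2 ^ k :=
  den_eq_two_pow_of_padicValuation_le fun p hp hp2 => @padicValuation_uC_le p ⟨hp⟩ hp2 n

/-- The denominators of `d_n²wₙ` and `d_n⁵vₙ` are powers of `2`. -/
theorem den_wC_vC (n : ℕ) :
    (∃ k : ℕ, ((((Nat.lcmUpto n : ℕ) : ℚ) ^ 2 * wC n)).den = 2 ^ k) ∧
      ∃ k : ℕ, ((((Nat.lcmUpto n : ℕ) : ℚ) ^ 5 * vC n)).den = 2 ^ k :=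
  ⟨den_eq_two_pow_of_padicValuation_le fun p hp hp2 => @padicValuation_lcmUpto_sq_mul_wC_le p ⟨hp⟩ hp2 n,
    den_eq_two_pow_of_padicValuation_le fun p hp hp2 => @padicValuation_lcmUpto_pow_five_mul_vC_le p ⟨hp⟩ hp2 n⟩

end Zudilin

end

end Summit.KontsevichZagierPeriods.Zeta5Search.BrickDenominators
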